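import Summits.Langlands.Langlands.Theses.ImaginaryQuadraticAnchor
import Summits.Langlands.Langlands.Theorems.IrreducibilityBySelfDualityReciprocityUpToIrreducibilityCorrespondsConj

/-!
# Birth skeleton (BC3) for crux stmt-Langlands-18737
`Summit.Langlands.Langlands.Theses.ImaginaryQuadraticAnchor.ReciprocityImagQuad` — line `birth`

Route `route-Langlands-ImaginaryQuadraticAnchor` (`closes : ReciprocityImagQuad → WeakAutomorphicInduction →
RelativeDescent → CanonicalReciprocityData → AnchorAssembly → CMFreeQuadraticPatch → Langlands`). The crux is the
route's declared RESIDUAL: `GL_n` reciprocity over every imaginary quadratic field `K` (`IsTotallyComplex K`,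
`finrank ℚ K = 2`), BOTH directions, for EVERY reciprocity datum `Rec` (the summit's second conjunct verbatim,
restricted to the anchor class):
`∀ K imag. quadratic, ∀ Rec n, 0 < n → ∀ hcpt, AutomorphicToGalois n Rec hcpt ∧ GaloisToAutomorphic n Rec hcpt`.

This file concludes the crux BY NAME from five named stubs, cut along the seams the literature itself respects
for Galois representations of automorphic forms over CM fields (construction / irreducibility / `ℓ ≠ p`
compatibility / `ℓ = p` compatibility) plus the weak form of direction (B) (Fontaine–Mazur–Langlands up to
a.e. Satake–Frobenius matching); the sixth clause (uniqueness up to conjugacy in (A)) and the weak-to-strong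
upgrade of (B) are THEOREMS of the tree (Chebotarev + Brauer–Nesbitt:
`Theorems.ReciprocityUpToIrreducibility.isConjugate_of_satakeFrobCompatibleAt`; the local–global clauses of (B)
are supplied by the same stubs 3/4 that serve (A), so the two directions share their local content):

* `stub_satakeExistenceIQ` — CONSTRUCTION (datum-free core of (A)): every L-algebraic cuspidal `π` of
  `GL_n(𝔸_K)`, `K` imaginary quadratic, `n ≥ 1`, has for all `ℓ, ι` SOME `ρ : Γ_K → GL_n(ℚ̄_ℓ)` Satake–Frobenius
  compatible with `(π, ι)` at almost all places (Buzzard–Gee Conj. 3.2.2, weakest form). Known for REGULAR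
  (cohomological) `π` (Harris–Lan–Taylor–Thorne 2016 Thm. A / Scholze 2015 Cor. V.4.2; tree named fact
  `Literature.NumberTheory.Automorphic.exists_galoisRep_of_regularAlgebraic`, C-normalised); OPEN CORE: the
  Hodge-irregular sector (base changes of Maass `λ = 1/4` forms, weight-one type in rank `n`), where not even
  algebraicity of the Satake parameters is known. The imaginary-quadratic restriction of stub 1 of the sibling
  skeleton `Cruxes/AutToGalCM/Lines/birth.lean` (crux stmt-Langlands-1059).
* `stub_irreducibleIQ` — IRREDUCIBILITY: every `ρ` Satake–Frobenius compatible a.e. with an L-algebraic CUSPIDAL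
  `π` over an imaginary quadratic field (`n ≥ 1`) is irreducible (the Irreducibility Conjecture; Calegari–Gee 2013
  §1, Hui 2023; "conjectured to be the case", A'Campo–Hevesi–Thorne–Whitmore 2026 §1.3). Known `n ≤ 3`, partially
  `n ≤ 6`, regular polarizable `π` for a density-one set of `ℓ` (Patrikis–Taylor 2015); OPEN for all `ℓ` in
  general rank and entirely open in irregular weight. Guard `0 < n` (negatives index, stmt-Langlands-17212: the
  rank-0 datum is compatible but not irreducible).
* `stub_localGlobalAwayIQ` — `ℓ ≠ p` COMPATIBILITY for irreducible compatible pairs, for EVERY reciprocity datum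
  `Rec` (the crux quantifies `∀ Rec`; statement re-type p141787): Taylor 2004 Conj. 7 at `v ∤ ℓ` through the
  Grothendieck–Deligne recipe `IsWeilDeligneOfLadic` (a definition of the tree — meaningful today). Known for
  regular `π` up to semisimplification (Varma 2024); the monodromy operator open in general; irregular weight:
  open with stub 1. Also carries the Henniart-sharpness of `IsLocalLanglandsGL` (every pinned datum has the same
  `rec_v` on generic classes).
* `stub_pAdicHodgeIQ` — `ℓ = p` COMPATIBILITY (Taylor 2004 Conj. 7 at `v ∣ ℓ` through Fontaine's PINNED `D_pst`
  datum) TOGETHER WITH de Rham-ness above `ℓ`, for every datum `Rec` already compatible away from `ℓ` (antecedent =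
  body of stub 3 for this `Rec`, which pins `rec_v(π_v)` at `v ∣ ℓ` by `ℓ`-independence). Known sectors: regular
  conjugate-self-dual (Caraiani 2014), regular `π` up to semisimplification (A'Campo–Hevesi–Thorne–Whitmore 2026
  Thm. 1.2.1: de Rham + `WD(r|_{G_{F_v}})^{ss} ≅ ι⁻¹ rec(π_v)^{ss}`), crystalline/ordinary `GL_2` over imaginary
  quadratic fields (Caraiani–Newton 2023 §4); OPEN in general (monodromy; irregular weight). PRESENT-TREE STATUS
  (recorded, not hidden): the pinned datum is Hilbert's `ε` over `IsFontaineDatum`, formally decidable today only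
  on the unramified-at-`v` sector until the construction `WD ∘ D_pst` (definition items D1/D2 of `FontaineDpst`)
  lands — as for the sibling cruxes 1059 / 14328.
* `stub_weakAutomorphyIQ` — WEAK (B) (datum-free core of direction (B); Fontaine–Mazur 1995 Conj. 1 + Langlands,
  Taylor 2004 Conj. 8, weakest form): every irreducible `ρ : Γ_K → GL_n(ℚ̄_ℓ)`, `K` imaginary quadratic,
  unramified a.e. and de Rham above `ℓ` for Fontaine's pinned datum, is Satake–Frobenius compatible a.e. with SOME
  L-algebraic cuspidal `π` of `GL_n(𝔸_K)`. Known: `n = 1` (class field theory + Weil), many `GL_2` cases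
  (Caraiani–Newton 2023 Thm. 1.1: modularity of elliptic curves over imaginary quadratic `F` with `X_0(15)(F)`
  finite; Allen–Khare–Thorne-type lifting), potential automorphy of regular compatible systems over CM fields
  (ACCGHLNSTT 2023); OPEN CORE: residually reducible, Hodge-irregular, `ℓ = 2`, general rank.

The composition `ReciprocityImagQuad_of` is kernel-checked and sorry-free and is NOT a one-line seam: for
`K, Rec, n, hcpt` it first assembles local–global compatibility at EVERY finite place for every irreducible
a.e.-compatible pair (case split `ℓ ∈ v` / `ℓ ∉ v` over stubs 4 / 3); direction (A): `ρ` from stub 1,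
irreducible by stub 2, `IsGeometricFramed Rec ρ` assembled (unramified a.e. is INSIDE Satake–Frobenius
compatibility; de Rham above `ℓ` from stub 4 — `ReciprocityData.pst` is the pinned datum by `rfl`),
`Corresponds Rec ι π ρ`, and the uniqueness clause PROVED from the landed rigidity theorem; direction (B): `π`
from stub 5 (fed with the two halves of `IsGeometricFramed Rec ρ`), upgraded from a.e. matching to `Corresponds`
by the same local–global block.

Tightness (informal; modulo the in-print support `CanonicalReciprocityData` = `Nonempty (ReciprocityData K)`,
Harris–Taylor Thm. A / Henniart, without which the `∀ Rec` crux would be vacuous while stubs 1, 2, 5 are not):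
stub 1 ⇐ crux (drop clauses); stub 2 ⇐ crux by `IrreducibleOffSector.isIrreducible_of_satakeFrobCompatible`;
stubs 3/4 ⇐ crux for the same `Rec` by `corresponds_of_exists_corresponds` / `isGeometricFramed_of_isConjugate`;
stub 5 ⇐ crux (B) (drop the local–global clause). So no stub is a strengthening that could die while the crux
lives, and none is the crux or the summit: each of stubs 1–4 lacks direction (B), stub 5 lacks (A) (BC3 probes,
folder `bc/probes/`).

Shape (for `ledger skeleton check` / `#h21_check_skeleton`): each stub is `theorem stub_<name> : <Prop> := by
sorry` (closed statements over existing declarations only); `_Goal.stub_<name> : Prop := type_of% @stub_<name>`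
names that statement; `ReciprocityImagQuad_of (h₁ : _Goal.stub_satakeExistenceIQ) … (h₅ : _Goal.stub_weakAutomorphyIQ)
: ReciprocityImagQuad` concludes the route decl BY NAME; the last `example` feeds the five stubs to it.

Supersedes the 2-stub (A)/(B) skeleton registered at type-sketch time (`stub_autToGal_imagQuad`,
`stub_galToAut_imagQuad`, sha a9eb1cc1…, never written to `Cruxes/`): those two statements are exactly the two
conjuncts proved inside `ReciprocityImagQuad_of` below (its `refine ⟨?_, ?_⟩` branches), so a proof of either old
stub is recovered from stubs 1–4 resp. 3–5 here.

Disproof used: none exists — `ledger crux ls stmt-Langlands-18737` lists no workfiles (no `Disproof.lean`, no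
`Negative/` lemma, no dead line, no crux ideas) at registration time (2026-08-17); `ledger negatives --problem
Langlands` contains nothing of the shape of these stubs; the one lesson that transfers (17212: rank-`0` data) is
honoured by the guard `0 < n` in every stub. The birth-vetting refuter's note (W.lean, 2026-08-17: non-vacuity
witnesses `K = ℚ(√-1)`, `hcpt`, `n = 1`; vacuity caveat on `∀ Rec`) is honoured by keeping stubs 1, 2, 5 datum-free.
-/

set_option linter.dupNamespace false

noncomputable section

namespace Summit.Langlands.Langlands.Cruxes.ReciprocityImagQuad.Birth

open Summit.Langlands.Langlands.Theses.ImaginaryQuadraticAnchor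
open Literature.NumberTheory.Automorphic Literature.NumberTheory.GaloisRepresentations
open Filter IsDedekindDomain
open scoped NumberField

/-! ## 1. The five stubs -/

/-- **STUB 1 — construction of the compatible system over imaginary quadratic fields, all ranks, ALL weights
(datum-free core of direction (A); Buzzard–Gee Conj. 3.2.2 in its weakest form).** For an imaginary quadratic
field `K`, every L-algebraic cuspidal `π` of `GL_n(𝔸_K)`, `n ≥ 1`, has for all `ℓ` and `ι : ℚ̄_ℓ ≃ ℂ` SOME
`ρ : Γ_K → GL_n(ℚ̄_ℓ)` which is Satake–Frobenius compatible with `(π, ι)` at all but finitely many places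
(`SatakeFrobCompatibleAt` includes unramifiedness of `ρ` there; no irreducibility, no de Rham clause, no
local–global compatibility, no uniqueness asked). Regular (cohomological) `π`: Harris–Lan–Taylor–Thorne Thm. A /
Scholze Cor. V.4.2 (tree named fact `exists_galoisRep_of_regularAlgebraic`, C-normalisation). OPEN CORE:
Hodge-irregular `π`. Why it might fail as typed: an L-algebraic cuspidal `π` with a transcendental Satake
parameter has no such `ρ` for generic `ι`.
[cite: HarrisLanTaylorThorneRMS2016, Thm. A] [cite: Scholze2015, Cor. V.4.2] [cite: BuzzardGeeLMS2014, Conj. 3.2.2] -/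
theorem stub_satakeExistenceIQ : ∀ (K : Type) [Field K] [NumberField K], NumberField.IsTotallyComplex K → Module.finrank ℚ K = 2 → ∀ (n : ℕ), 0 < n → ∀ (hcpt : isCompact_glFiniteIntegralLevel n K) (π : CuspidalAutomorphicRepData n K hcpt), π.1.IsLAlgebraic → ∀ (ℓ : ℕ) [Fact ℓ.Prime] (ι : PadicAlgCl ℓ ≃+* ℂ), ∃ ρ : FramedGaloisRep K (PadicAlgCl ℓ) n, ∀ᶠ v : HeightOneSpectrum (𝓞 K) in cofinite, SatakeFrobCompatibleAt ι π.1 ρ v := by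
  sorry

/-- **STUB 2 — irreducibility of compatible avatars of CUSPIDAL `π` over imaginary quadratic fields (the
Irreducibility Conjecture for automorphic Galois representations).** For an imaginary quadratic field `K`,
`n ≥ 1`, an L-algebraic cuspidal `π` of `GL_n(𝔸_K)` and any `ℓ, ι`: every `ρ : Γ_K → GL_n(ℚ̄_ℓ)` Satake–Frobenius
compatible with `(π, ι)` at almost all places is irreducible. Known: `n ≤ 3`; `n ≤ 6` in many cases (Calegari–Gee
2013, Hui 2023); regular polarizable `π` for a density-one set of `ℓ` (Patrikis–Taylor 2015). OPEN for all `ℓ` in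
general rank, and entirely open in irregular weight — a hidden open core of the crux as typed
(`AutomorphicToGalois` demands `IsIrreducible` at every `ℓ, ι`). Guard `0 < n`: negatives index,
stmt-Langlands-17212. Why it might fail: only through a genuinely reducible `ρ_{π,ℓ}` for a cuspidal `π`.
[cite: CalegariGee2013, §1] [cite: Hui2023, Thm. 1.1] [cite: PatrikisTaylor2015, Thm. A] -/
theorem stub_irreducibleIQ : ∀ (K : Type) [Field K] [NumberField K], NumberField.IsTotallyComplex K → Module.finrank ℚ K = 2 → ∀ (n : ℕ), 0 < n → ∀ (hcpt : isCompact_glFiniteIntegralLevel n K) (π : CuspidalAutomorphicRepData n K hcpt), π.1.IsLAlgebraic → ∀ (ℓ : ℕ) [Fact ℓ.Prime] (ι : PadicAlgCl ℓ ≃+* ℂ) (ρ : FramedGaloisRep K (PadicAlgCl ℓ) n), (∀ᶠ v : HeightOneSpectrum (𝓞 K) in cofinite, SatakeFrobCompatibleAt ι π.1 ρ v) → ρ.toGaloisRep.IsIrreducible := by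
  sorry

/-- **STUB 3 — local–global compatibility AWAY from `ℓ` for irreducible compatible pairs, for EVERY reciprocity
datum (Taylor 2004 Conj. 7 at `v ∤ ℓ`; the crux quantifies `∀ Rec`).** For an imaginary quadratic field `K` and
every reciprocity datum `Rec` (local Langlands correspondences `rec_v` pinned to the canonical Artin maps), every
L-algebraic cuspidal `π` of `GL_n(𝔸_K)`, `n ≥ 1`, every `ℓ, ι` and every IRREDUCIBLE `ρ` Satake–Frobenius
compatible with `(π, ι)` a.e. satisfy `LocalGlobalCompatibleAt Rec ι π ρ v` at every finite `v ∤ ℓ`: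
`ι WD(ρ|_{W_{K_v}})^{F-ss} ≅ rec_v(π_v)` with `WD` by the Grothendieck–Deligne recipe (`IsWeilDeligneOfLadic`, a
definition of the tree). Known for regular `π` up to semisimplification (Varma 2024); monodromy open in general;
irregular weight: open with stub 1. Why it might fail as typed: a pinned datum whose `rec_v` differed from
Harris–Taylor's on a generic class (if `IsLocalLanglandsGL` were not Henniart-sharp) — then the crux fails too.
[cite: TaylorGaloisRepresentations2004, Conj. 3.4] [cite: VarmaFMS2024, Thm. 1] [cite: HarrisTaylorAMS2001, Thm. A] -/
theorem stub_localGlobalAwayIQ : ∀ (K : Type) [Field K] [NumberField K], NumberField.IsTotallyComplex K → Module.finrank ℚ K = 2 → ∀ (Rec : ReciprocityData K) (n : ℕ), 0 < n → ∀ (hcpt : isCompact_glFiniteIntegralLevel n K) (π : CuspidalAutomorphicRepData n K hcpt), π.1.IsLAlgebraic → ∀ (ℓ : ℕ) [Fact ℓ.Prime] (ι : PadicAlgCl ℓ ≃+* ℂ) (ρ : FramedGaloisRep K (PadicAlgCl ℓ) n), ρ.toGaloisRep.IsIrreducible → (∀ᶠ v : HeightOneSpectrum (𝓞 K) in cofinite,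 SatakeFrobCompatibleAt ι π.1 ρ v) → ∀ v : HeightOneSpectrum (𝓞 K), ((ℓ : ℕ) : 𝓞 K) ∉ v.asIdeal → LocalGlobalCompatibleAt Rec ι π.1 ρ v := by
  sorry

/-- **STUB 4 — the `p`-adic Hodge clauses above `ℓ` (Taylor 2004 Conj. 7 at `v ∣ ℓ` + Fontaine–Mazur
geometricity): de Rham-ness AND local–global compatibility through Fontaine's PINNED `D_pst` datum, for every
reciprocity datum already compatible away from `ℓ`.** For an imaginary quadratic field `K` and reciprocity data
`Rec` satisfying the body of stub 3 (compatibility at all `v ∤ ℓ` for all irreducible compatible pairs in all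
ranks), every irreducible `ρ` Satake–Frobenius compatible a.e. with an L-algebraic cuspidal `π` (`n ≥ 1`) is, at
every `v ∣ ℓ`, de Rham for the pinned datum `fontainePstAdicCompletion v ℓ hv` (= `Rec.pst ℓ v hv` by `rfl`) and
locally–globally compatible with `π` there. Known sectors: regular conjugate-self-dual `π` (Caraiani 2014, incl.
monodromy), regular `π` up to semisimplification (A'Campo–Hevesi–Thorne–Whitmore 2026, Thm. 1.2.1),
crystalline/ordinary rank 2 over imaginary quadratic fields (Caraiani–Newton 2023 §4); OPEN in general.
PRESENT-TREE STATUS: decidable today only on the unramified-at-`v` sector of the pinned specification, pending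
the construction `WD ∘ D_pst` (definition items D1/D2 of `FontaineDpst`). Why it might fail as typed: a datum
compatible away from `ℓ` is pinned on every local component class by `ℓ`-independence, so failure means failure
of (A) itself.
[cite: TaylorGaloisRepresentations2004, Conj. 3.5] [cite: Caraiani2014, Thm. 1.1] [cite: CaraianiNewton2023, Thm. 4.1] [cite: FontaineMazurGeometric1995, §1] -/
theorem stub_pAdicHodgeIQ : ∀ (K : Type) [Field K] [NumberField K], NumberField.IsTotallyComplex K → Module.finrank ℚ K = 2 → ∀ (Rec : ReciprocityData K), (∀ (n : ℕ), 0 < n → ∀ (hcpt : isCompact_glFiniteIntegralLevel n K) (π : CuspidalAutomorphicRepData n K hcpt), π.1.IsLAlgebraic → ∀ (ℓ : ℕ) [Fact ℓ.Prime] (ι : PadicAlgCl ℓ ≃+* ℂ) (ρ : FramedGaloisRep K (PadicAlgCl ℓ) n), ρ.toGaloisRep.IsIrreducible → (∀ᶠ v : HeightOneSpectrum (𝓞 K) in cofinite, SatakeFrobCompatibleAt ι π.1 ρ v) → ∀ v : HeightOneSpectrum (𝓞 K), ((ℓ : ℕ) : 𝓞 K) ∉ v.asIdeal → LocalGlobalCompatibleAt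 Rec ι π.1 ρ v) → ∀ (n : ℕ), 0 < n → ∀ (hcpt : isCompact_glFiniteIntegralLevel n K) (π : CuspidalAutomorphicRepData n K hcpt), π.1.IsLAlgebraic → ∀ (ℓ : ℕ) [Fact ℓ.Prime] (ι : PadicAlgCl ℓ ≃+* ℂ) (ρ : FramedGaloisRep K (PadicAlgCl ℓ) n), ρ.toGaloisRep.IsIrreducible → (∀ᶠ v : HeightOneSpectrum (𝓞 K) in cofinite, SatakeFrobCompatibleAt ι π.1 ρ v) → ∀ (v : HeightOneSpectrum (𝓞 K)) (hv : ((ℓ : ℕ) : 𝓞 K) ∈ v.asIdeal), (Literature.NumberTheory.PAdicHodge.fontainePstAdicCompletion v ℓ hv).IsDeRhamFramed (ρ.toLocal v) ∧ LocalGlobalCompatibleAt Rec ι π.1 ρ v := by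
  sorry

/-- **STUB 5 — weak direction (B) over imaginary quadratic fields (datum-free core of (B): Fontaine–Mazur Conj. 1
with Langlands, Taylor 2004 Conj. 8, up to a.e. Satake–Frobenius matching).** For an imaginary quadratic field
`K`, `n ≥ 1`, `ℓ`, `ι`: every IRREDUCIBLE `ρ : Γ_K → GL_n(ℚ̄_ℓ)` unramified at all but finitely many places and de
Rham above `ℓ` for Fontaine's pinned datum (the two halves of `IsGeometricFramed Rec ρ`, which does not depend on
`Rec`) is Satake–Frobenius compatible at almost all places with SOME L-algebraic cuspidal `π` of `GL_n(𝔸_K)` (no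
local–global clause asked: that upgrade is stubs 3/4 + the landed rigidity). Known: `n = 1` (class field theory,
Weil's algebraic Hecke characters); rank 2 in the Barsotti–Tate / ordinary sectors (Caraiani–Newton 2023 Thm. 1.1
and §5–7); POTENTIAL automorphy of regular compatible systems (ACCGHLNSTT 2023); OPEN CORE: residually
reducible, Hodge-irregular, `ℓ = 2`, general rank `n ≥ 3`. Why it might fail: only with Fontaine–Mazur itself
(an irreducible geometric `ρ` over `K` attached to no cusp form).
[cite: FontaineMazurGeometric1995, Conj. 1] [cite: CaraianiNewton2023, Thm. 1.1] [cite: ACCGHLNSTT2023, Thm. 1.0.1] [cite: BuzzardGeeLMS2014, Conj. 3.2.2] -/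
theorem stub_weakAutomorphyIQ : ∀ (K : Type) [Field K] [NumberField K], NumberField.IsTotallyComplex K → Module.finrank ℚ K = 2 → ∀ (n : ℕ), 0 < n → ∀ (hcpt : isCompact_glFiniteIntegralLevel n K) (ℓ : ℕ) [Fact ℓ.Prime] (ι : PadicAlgCl ℓ ≃+* ℂ) (ρ : FramedGaloisRep K (PadicAlgCl ℓ) n), ρ.toGaloisRep.IsIrreducible → (∀ᶠ v : HeightOneSpectrum (𝓞 K) in cofinite, ρ.IsUnramifiedAt v) → (∀ (v : HeightOneSpectrum (𝓞 K)) (hv : ((ℓ : ℕ) : 𝓞 K) ∈ v.asIdeal), (Literature.NumberTheory.PAdicHodge.fontainePstAdicCompletion v ℓ hv).IsDeRhamFramed (ρ.toLocal v)) → ∃ π : CuspidalAutomorphicRepData n K hcpt, π.1.IsLAlgebraic ∧ ∀ᶠ v : HeightOneSpectrum (𝓞 K) in cofinite, SatakeFrobCompatibleAt ι π.1 ρ v := by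
  sorry

/-! ## 2. The stub statements as named propositions (the composition's hypotheses, by name)

`_Goal` is internal on purpose: audits listing the file's declarations by short name find the `stub_*`
THEOREMS, while `#h21_check_skeleton` accepts the hypotheses of `ReciprocityImagQuad_of` by the stub names they
carry. Each `_Goal.stub_x` is `type_of% @stub_x` — no text duplicated, no `sorry` inherited. -/

namespace _Goal

/-- The statement of `stub_satakeExistenceIQ`, as a named `Prop` (literally its type). [folklore] -/
def stub_satakeExistenceIQ : Prop :=
  type_of% @Summit.Langlands.Langlands.Cruxes.ReciprocityImagQuad.Birth.stub_satakeExistenceIQ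

/-- The statement of `stub_irreducibleIQ`, as a named `Prop` (literally its type). [folklore] -/
def stub_irreducibleIQ : Prop :=
  type_of% @Summit.Langlands.Langlands.Cruxes.ReciprocityImagQuad.Birth.stub_irreducibleIQ

/-- The statement of `stub_localGlobalAwayIQ`, as a named `Prop` (literally its type). [folklore] -/
def stub_localGlobalAwayIQ : Prop :=
  type_of% @Summit.Langlands.Langlands.Cruxes.ReciprocityImagQuad.Birth.stub_localGlobalAwayIQ

/-- The statement of `stub_pAdicHodgeIQ`, as a named `Prop` (literally its type). [folklore] -/
def stub_pAdicHodgeIQ : Prop :=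
  type_of% @Summit.Langlands.Langlands.Cruxes.ReciprocityImagQuad.Birth.stub_pAdicHodgeIQ

/-- The statement of `stub_weakAutomorphyIQ`, as a named `Prop` (literally its type). [folklore] -/
def stub_weakAutomorphyIQ : Prop :=
  type_of% @Summit.Langlands.Langlands.Cruxes.ReciprocityImagQuad.Birth.stub_weakAutomorphyIQ

end _Goal

/-! ## 3. The composition (kernel-checked, no `sorry`):
LGC everywhere (stubs 3/4) → (A) = construction → irreducibility → geometric → corresponds → uniqueness (a
theorem); (B) = weak automorphy → corresponds (same LGC block) → crux by name -/

/-- **`ReciprocityImagQuad` from the five stubs.** For an imaginary quadratic `K`, a datum `Rec`, `n ≥ 1`,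
`hcpt`: local–global compatibility at every finite place for every irreducible a.e.-compatible pair (case split
`ℓ ∈ v` / `ℓ ∉ v`: stub 4 fed with stub 3 / stub 3); (A): `ρ` from stub 1, irreducible by stub 2,
`IsGeometricFramed Rec ρ` = unramified a.e. (inside Satake–Frobenius compatibility) ∧ de Rham above `ℓ` (stub 4;
`Rec.pst` is the pinned datum by `rfl`), `Corresponds Rec ι π ρ`, uniqueness up to conjugacy among all
corresponding `ρ'` by the landed Chebotarev–Brauer–Nesbitt rigidity `isConjugate_of_satakeFrobCompatibleAt`;
(B): `π` from stub 5, `Corresponds` by the local–global block. The hypotheses are, by name, the statements of the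
five stubs; the conclusion is the route decl. [cite: DeligneSerreASENS1974, Lemme 3.2] -/
theorem ReciprocityImagQuad_of (h₁ : _Goal.stub_satakeExistenceIQ) (h₂ : _Goal.stub_irreducibleIQ)
    (h₃ : _Goal.stub_localGlobalAwayIQ) (h₄ : _Goal.stub_pAdicHodgeIQ) (h₅ : _Goal.stub_weakAutomorphyIQ) :
    ReciprocityImagQuad := by
  unfold _Goal.stub_satakeExistenceIQ at h₁
  unfold _Goal.stub_irreducibleIQ at h₂
  unfold _Goal.stub_localGlobalAwayIQ at h₃
  unfold _Goal.stub_pAdicHodgeIQ at h₄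
  unfold _Goal.stub_weakAutomorphyIQ at h₅
  intro K _ _ hK hK2 Rec n hn hcpt
  -- the datum `Rec`: compatible away from `ℓ` (stub 3), hence also above `ℓ` (stub 4)
  have hAway := h₃ K hK hK2 Rec
  have hAbove := h₄ K hK hK2 Rec hAway
  -- local–global compatibility at EVERY finite place, for every irreducible a.e.-compatible pair
  have hLGC : ∀ (π : CuspidalAutomorphicRepData n K hcpt), π.1.IsLAlgebraic →
      ∀ (ℓ : ℕ) [Fact ℓ.Prime] (ι : PadicAlgCl ℓ ≃+* ℂ) (ρ : FramedGaloisRep K (PadicAlgCl ℓ) n),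
        ρ.toGaloisRep.IsIrreducible →
          (∀ᶠ v : HeightOneSpectrum (𝓞 K) in cofinite, SatakeFrobCompatibleAt ι π.1 ρ v) →
            ∀ v : HeightOneSpectrum (𝓞 K), LocalGlobalCompatibleAt Rec ι π.1 ρ v := by
    intro π hL ℓ _ ι ρ hirr hρ v
    by_cases hv : ((ℓ : ℕ) : 𝓞 K) ∈ v.asIdeal
    · exact (hAbove n hn hcpt π hL ℓ ι ρ hirr hρ v hv).2
    · exact hAway n hn hcpt π hL ℓ ι ρ hirr hρ v hv
  refine ⟨?_, ?_⟩
  · -- (A) automorphic → Galois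
    intro π hL ℓ _ ι
    obtain ⟨ρ, hρ⟩ := h₁ K hK hK2 n hn hcpt π hL ℓ ι
    have hirr : ρ.toGaloisRep.IsIrreducible := h₂ K hK hK2 n hn hcpt π hL ℓ ι ρ hρ
    have hgeo : IsGeometricFramed Rec ρ :=
      ⟨hρ.mono fun v hv => by
          obtain ⟨α, -, hur, -⟩ := hv
          exact hur,
        fun v hv => (hAbove n hn hcpt π hL ℓ ι ρ hirr hρ v hv).1⟩
    exact ⟨ρ, hirr, hgeo, ⟨hρ, hLGC π hL ℓ ι ρ hirr hρ⟩, fun ρ' h' =>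
      Theorems.ReciprocityUpToIrreducibility.isConjugate_of_satakeFrobCompatibleAt π.1 ι hirr hρ h'.1⟩
  · -- (B) Galois → automorphic
    intro ℓ _ ι ρ hirr hgeo
    obtain ⟨π, hL, hρ⟩ := h₅ K hK hK2 n hn hcpt ℓ ι ρ hirr hgeo.1 (fun v hv => hgeo.2 v hv)
    exact ⟨π, hL, hρ, hLGC π hL ℓ ι ρ hirr hρ⟩

/-- By-name sanity check (an `example`, not a declaration of the file): the five stubs feed the composition as
they stand. -/
example : ReciprocityImagQuad :=
  ReciprocityImagQuad_of stub_satakeExistenceIQ stub_irreducibleIQ stub_localGlobalAwayIQ stub_pAdicHodgeIQ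
    stub_weakAutomorphyIQ

end Summit.Langlands.Langlands.Cruxes.ReciprocityImagQuad.Birth

end
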